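import Summits.ABC.StewartYu.PadicG3ParOdd
import HarnessLib

set_option linter.dupNamespace false

/-!
# Crux `Y07Odd` (stmt-ABC-19658), line `gen3-slab-odd` — registered stub `stub_ordLineG` (the `Λ`-order line)

`Summits/ABC/ABC/Theorems/PadicPrimesKummerThirdY07OddStubOrdLineG.lean` — cell `abc-stewartyu`, lead p2-g4.  Under the NEGATED BOUND
`¬ (ord_p(∏αⱼ^{bⱼ} − 1)·log p ≤ 256ⁿ (p/log p) ∏Vⱼ (W + log p + log 2Vmax))`: `∏αⱼ^{bⱼ} ≠ 1` (else the order is `0`), and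
`(m+1) + ord_p(b_{j₀}) ≤ ord_p(∏αⱼ^{bⱼ} − 1)` because `ord_p(b_{j₀})·log p ≤ log|b_{j₀}| ≤ W`, `(m+1)·log p ≤ 8(n+1) + 2 log p`
(`PadicG3Par.m_le`) and `256ⁿ·(W + log p) ≥ W + 2 log p + 8(n+1)`.  Elementary; no named fact.
-/

namespace Summit.ABC.ABC.Cruxes.Y07Odd.SlabOdd

open Finset

/-- `8n + 9 ≤ 256ⁿ` for `n ≥ 1`. [folklore] -/
theorem eight_mul_add_nine_le_pow {n : ℕ} (hn : 1 ≤ n) : (8 : ℝ) * n + 9 ≤ (256 : ℝ) ^ n := by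
  have h1 : (n : ℝ) < (2 : ℝ) ^ n := by exact_mod_cast Nat.lt_two_pow_self
  have h2 : (17 : ℝ) * (2 : ℝ) ^ n ≤ (256 : ℝ) ^ n := by
    have : (256 : ℝ) ^ n = (128 : ℝ) ^ n * (2 : ℝ) ^ n := by rw [← mul_pow]; norm_num
    rw [this]
    refine mul_le_mul_of_nonneg_right ?_ (by positivity)
    calc (17 : ℝ) ≤ 128 := by norm_num
      _ = (128 : ℝ) ^ 1 := (pow_one _).symm
      _ ≤ (128 : ℝ) ^ n := pow_le_pow_right₀ (by norm_num) hn
  have h3 : (1 : ℝ) ≤ (2 : ℝ) ^ n := one_le_pow₀ (by norm_num)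
  nlinarith

/-- **Registered stub `stub_ordLineG`** of the skeleton `Lines/gen3-slab-odd.lean` (crux `Y07Odd`): the `Λ`-order line. [cite: Yu2013, §7; shape only] -/
theorem stub_ordLineG : ∀ (p : ℕ) [Fact p.Prime], p ≠ 2 → ∀ (S : Summit.ABC.StewartYu.G3Setup p), 2 ≤ S.n →
    ∀ (V : Fin S.n → ℝ) (Vmax W : ℝ),
    (∀ j, padicValRat p (S.α j) = 0) →
    (∀ κ : Fin S.n → ℤ, (∃ γ : ℚ, ∏ j, S.α j ^ κ j = γ ^ 2 ∨ ∏ j, S.α j ^ κ j = -γ ^ 2) → ∀ j, (2 : ℤ) ∣ κ j) →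
    (∀ j, Height.logHeight₁ (S.α j) ≤ V j) → (∀ j, 1 ≤ V j) → (∀ j, V j ≤ Vmax) →
    (∀ j, Real.log (max 3 (|S.b j| : ℝ)) ≤ W) → 1 ≤ W →
    ¬ (padicValRat p (∏ j, S.α j ^ S.b j - 1) : ℝ) * Real.log p ≤
        (256 : ℝ) ^ S.n * ((p : ℝ) / Real.log p) * (∏ j, V j) * (W + Real.log p + Real.log (2 * Vmax)) →
    ∀ (P : Summit.ABC.StewartYu.PadicG3Par S.n), P.p = p → P.A = V → P.Amax = Vmax → P.W = W → P.Nq = 1 → P.K₀ = p - 1 →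
      P.θ₀ = 1 / 2 →
      ∏ j, S.α j ^ S.b j ≠ 1 ∧ ((P.m + 1 : ℕ) : ℤ) + padicValInt p (S.b S.j₀) ≤ padicValRat p (∏ j, S.α j ^ S.b j - 1) := by
  intro p _ hp2 S hn2 V Vmax W _ _ _ hV1 hVm hWb hW hU P hPp _ _ _ _ _ _
  have hp : p.Prime := Fact.out
  have hp3 : 3 ≤ p := by have := hp.two_le; omega
  have hpR : (3 : ℝ) ≤ p := by exact_mod_cast hp3
  have hlogp : 0 < Real.log p := Real.log_pos (by linarith)
  have hn1 : 1 ≤ S.n := by omega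
  -- the right side of the bound is ≥ 256ⁿ (W + log p) ≥ W + 2 log p + 8(n+1) > 0
  have hVmax : 1 ≤ Vmax := le_trans (hV1 ⟨0, hn1⟩) (hVm ⟨0, hn1⟩)
  have hprodV : 1 ≤ ∏ j, V j := by
    calc (1 : ℝ) = ∏ _j : Fin S.n, (1 : ℝ) := by simp
      _ ≤ ∏ j, V j := prod_le_prod (fun _ _ => zero_le_one) fun j _ => hV1 j
  have hlog2V : 0 ≤ Real.log (2 * Vmax) := Real.log_nonneg (by linarith)
  have hpl : 1 ≤ (p : ℝ) / Real.log p := by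
    rw [le_div_iff₀ hlogp, one_mul]
    have := Real.log_le_sub_one_of_pos (show (0 : ℝ) < p by linarith)
    linarith
  set R : ℝ := (256 : ℝ) ^ S.n * ((p : ℝ) / Real.log p) * (∏ j, V j) * (W + Real.log p + Real.log (2 * Vmax)) with hR
  have hR1 : (256 : ℝ) ^ S.n * (W + Real.log p) ≤ R := by
    have h256 : (0 : ℝ) ≤ (256 : ℝ) ^ S.n := by positivity
    have hWl : 0 ≤ W + Real.log p := by linarith
    calc (256 : ℝ) ^ S.n * (W + Real.log p) = (256 : ℝ) ^ S.n * 1 * 1 * (W + Real.log p) := by ring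
      _ ≤ R := by
        rw [hR]
        exact mul_le_mul (mul_le_mul (mul_le_mul_of_nonneg_left hpl h256) hprodV zero_le_one (by positivity)) (by linarith)
          hWl (by positivity)
  have hR2 : W + 2 * Real.log p + 8 * (S.n + 1) ≤ R := by
    have h := eight_mul_add_nine_le_pow hn1
    have h256 : (1 : ℝ) ≤ (256 : ℝ) ^ S.n := one_le_pow₀ (by norm_num)
    -- (256ⁿ − 1) W + (256ⁿ − 2) log p ≥ 256ⁿ − 1 ≥ 8n + 8
    have hlogp3 : Real.log p ≤ p := le_trans (Real.log_le_sub_one_of_pos (by linarith)) (by linarith)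
    nlinarith [mul_le_mul_of_nonneg_left hW (by linarith : (0 : ℝ) ≤ (256 : ℝ) ^ S.n - 1),
      mul_nonneg (by linarith : (0 : ℝ) ≤ (256 : ℝ) ^ S.n - 2) hlogp.le]
  have hRpos : 0 < R := by have := hlogp; nlinarith
  -- the order `U`
  set U : ℤ := padicValRat p (∏ j, S.α j ^ S.b j - 1) with hUdef
  have hUlt : R < (U : ℝ) * Real.log p := by push Not at hU; rw [hR]; exact hU
  refine ⟨?_, ?_⟩
  · intro h1
    have hU0 : U = 0 := by rw [hUdef, h1, sub_self, padicValRat.zero]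
    rw [hU0] at hUlt; push_cast at hUlt; rw [zero_mul] at hUlt
    exact absurd hUlt (not_lt.mpr hRpos.le)
  · -- `ord_p(b_{j₀}) log p ≤ W`
    set v : ℕ := padicValInt p (S.b S.j₀) with hvdef
    have hv : (v : ℝ) * Real.log p ≤ W := by
      have hb0 : S.b S.j₀ ≠ 0 := S.bj₀_ne
      have hdvd : p ^ v ∣ (S.b S.j₀).natAbs := by rw [hvdef]; unfold padicValInt; exact pow_padicValNat_dvd
      have hle : p ^ v ≤ (S.b S.j₀).natAbs := Nat.le_of_dvd (Int.natAbs_pos.mpr hb0) hdvd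
      have hleR : (p : ℝ) ^ v ≤ |(S.b S.j₀ : ℝ)| := by
        rw [← Int.cast_abs, ← Nat.cast_natAbs]; exact_mod_cast hle
      have hpv : (0 : ℝ) < (p : ℝ) ^ v := by positivity
      calc (v : ℝ) * Real.log p = Real.log ((p : ℝ) ^ v) := by rw [Real.log_pow]
        _ ≤ Real.log |(S.b S.j₀ : ℝ)| := Real.log_le_log hpv hleR
        _ ≤ Real.log (max 3 (|S.b S.j₀| : ℝ)) := by
            rw [← Int.cast_abs]
            refine Real.log_le_log (by rw [Int.cast_abs]; exact lt_of_lt_of_le hpv hleR) ?_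
            push_cast; exact le_max_right _ _
        _ ≤ W := hWb S.j₀
    -- `(m+1) log p ≤ 8(n+1) + 2 log p`
    have hm : ((P.m + 1 : ℕ) : ℝ) * Real.log p ≤ 8 * (S.n + 1) + 2 * Real.log p := by
      have h := P.m_le
      rw [hPp] at h
      unfold Summit.ABC.StewartYu.PadicG3Par.cG at h
      push_cast
      have : (P.m : ℝ) * Real.log p ≤ 8 * (S.n + 1) + Real.log p := by
        have := mul_le_mul_of_nonneg_right h hlogp.le
        rw [add_mul, div_mul_cancel₀ _ hlogp.ne', one_mul] at this
        linarith
      nlinarith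
    -- compare
    have hk : (((P.m + 1 : ℕ) : ℤ) + (v : ℤ) : ℝ) * Real.log p < (U : ℝ) * Real.log p := by
      push_cast
      have : (((P.m + 1 : ℕ) : ℝ) + v) * Real.log p ≤ R := by
        rw [add_mul]; push_cast at hm ⊢; linarith
      push_cast at this
      linarith
    have hk' : (((P.m + 1 : ℕ) : ℤ) + (v : ℤ) : ℝ) < (U : ℝ) := lt_of_mul_lt_mul_right hk hlogp.le
    have hk'' : ((P.m + 1 : ℕ) : ℤ) + (v : ℤ) < U := by exact_mod_cast hk'
    rw [hvdef] at hk''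
    exact hk''.le

end Summit.ABC.ABC.Cruxes.Y07Odd.SlabOdd
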